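import Summits.HodgeConjecture.HodgeConjecture.Theorems.F0P6aSpecOrgansBlockI
import HarnessLib

/-!
# `F0P6aSpecOrgansTwoQuotLegs` — ★ RE-HOME of `Lines/F0_P6a_SpecOrgans.lean` (tree sha16 f8c3b4bc8f4404ac, 1249 l.), PART 3 of 5 — tree lines :611–:901
See PART 1 `Theorems/F0P6aSpecOrgansBlockC.lean` for the full ★ re-home header and the original module docstring (verbatim there).  Same namespace (every
fully-qualified name unchanged); the scopes open at the cut are re-opened below with their `variable` ∕ `open` ∕ `set_option` ∕ `universe` lines replayed verbatim
from the tree, in order; the code after the replay block is the tree bytes :611–:901, untouched except the (d1) cure named in PART 1.  HC_CM is proved only modulo the 7 printed citations (2 remaining: hLiu418 = stmt-HodgeConjecture-24832, h413 = stmt-HodgeConjecture-24833) until rung 0 closes; a re-home is count-neutral.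
-/

-- ── replay of the scopes open at tree line :611 (verbatim) ──
set_option autoImplicit false
set_option linter.dupNamespace false
noncomputable section
universe u
namespace Summit.HodgeConjecture.HodgeConjecture.Cruxes.HLiu418.F0P6aLineSpecialisation
section Block_I
open CategoryTheory CategoryTheory.Limits AlgebraicGeometry MonoidalCategory CartesianMonoidalCategory
set_option backward.isDefEq.respectTransparency false
open scoped MonObj
open Literature.AlgebraicGeometry.Motives Literature.AlgebraicGeometry.GroupSchemes Literature.AlgebraicGeometry.GroupSchemes.GroupSchemeKernel
open Literature.AlgebraicGeometry.GroupSchemes.AffineGroupScheme Literature.AlgebraicGeometry.GroupSchemes.TorsionLayer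
section QuotWDFold
open NumberField IsDedekindDomain MulAction
open scoped Matrix Pointwise
open Literature.NumberTheory.Automorphic Literature.NumberTheory.Automorphic.UnitaryGroup
open Literature.AlgebraicGeometry.ShimuraVarieties.UnitaryCanonicalModel
open Literature.NumberTheory.Automorphic.Liu2021.AppendixC
open Literature.AlgebraicGeometry.Motives (AlgPoints IntegralModel SchemeOver thickening thickeningGalAction thickeningLift specOver)
open Literature.NumberTheory.DiophantineGeometry (geomResidueField specialFibreFunctor specResidueField)
open Literature.AlgebraicGeometry.RelativeSpec (ActionOver)
open Literature.AlgebraicGeometry.AbelianSchemes Literature.AlgebraicGeometry.AbelianSchemes.AbelianSchemeOver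
open Summit.HodgeConjecture.HodgeConjecture.Cruxes.HLiu418.F0P6aModuliDatumDefs
open Summit.HodgeConjecture.HodgeConjecture.Cruxes.HLiu418.F0P6aRGDAssembly
open Summit.HodgeConjecture.HodgeConjecture.Cruxes.HLiu418.F0P6aDatumOfInputs
variable {F : Type} [Field F] [NumberField F] [IsCMField F] {ι₁ : F →+* ℂ}
    {Jstar : Matrix (Fin 2) (Fin 2) F}
    {K₀ : C5.OpenCompactSubgroup ↥(finAdelic ↥(maximalRealSubfield F) F (IsCMField.complexConj F) 2 Jstar)}
    {S : RecordSystemGS F Jstar ι₁ K₀} {hU7ₛ : S.HeckeTranslateDefinedOver}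
    {hJ : (Jstar.map (IsCMField.complexConj F))ᵀ = Jstar} {hJu : IsUnit Jstar}
    {Fi : Type} [Field Fi] [Algebra F Fi] {Kc : C5.SmallLevel K₀} {G : Type} [Group G]
    {𝓜 : IntegralModel (𝓞 F) F ((thickening F Fi).obj (S.M.obj Kc))}
    {w : HeightOneSpectrum (𝓞 F)} {hw : (IsCMField.complexConj F) • w ≠ w} {h𝓨 : (𝓜.localise w).IsSmoothProper 1}
    {θ : ActionOver (𝓜.localise w).total.hom ((Fi ≃ₐ[F] Fi) × G)}
    {e : Fi →ₐ[F] AlgebraicClosure (w.adicCompletion F)}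

set_option maxHeartbeats 400000 in
/-- **(C6′)-OF-CUT `comp_eq_one_iff_of_two_quotLegs_of_cut`** — the fold's second half, stated over the OUTPUT of (s-H2) ★ `exists_twoBlock_hermitianDuality_pairing` at `A_x̄`
(`G′ = A_x̄[𝔭_w𝔭_{c•w}]` realised by `j′` with its points clause `hj′`, the duality `e`, the idempotents `εW εV` with `hεVj hsum hVV hadj`, the pairing clause `hpair`, and the
`p`-torsion row `hG′p`) plus the two legs' rows: (s-REAL) ★ `exists_interLayer`, (s-LAG) ★ `exists_comp_eq_iff_of_descent`, (s-FIX) from `e_{c•w} ∈ 𝔭_w` and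
`(𝔡 x̄).hkerG₀`, then §1.  Split off so that every declaration stays ≤ 400 000 heartbeats. [cite: MumfordAV1970, §23 Thm. 2 (p. 231)]
[cite: Tate1997FiniteFlatGroupSchemes, §(3.8) pp. 145–146] [cite: Liu2021, Prop. D.8 p. 135, p. 137] -/
theorem comp_eq_one_iff_of_two_quotLegs_of_cut (I : RGDInputsAt F ι₁ Jstar K₀ S hU7ₛ hJ hJu Fi Kc G 𝓜 w hw h𝓨 θ e) [ExpChar (geomResidueField w) I.pChar]
    [IsCommMonObj I.univ.X]
    {m : ℕ} (E' : Matrix (Fin m) (Fin m) (𝓞 F)) (hE' : E' * E' = E')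
    (𝔡 : ∀ xbar, DockAt I xbar) (xbar : AlgPoints (𝓜.localise w).reductionAt (geomResidueField w)) (H : SubOf I 𝔡 xbar)
    -- the CRT element of the `c•w`-block and its membership
    (ecw : 𝓞 F) (hecw𝔭 : ecw ∈ w.asIdeal)
    -- the cut (output of ★ `exists_twoBlock_hermitianDuality_pairing` at `A_x̄`, `I := 𝔭_w𝔭_{c•w}`)
    (G' : SchemeOver (geomResidueField w)) [GrpObj G'] [IsCommMonObj G'] [IsAffine G'.left]
    [Module.Free (geomResidueField w) (Alg G')] [Module.Finite (geomResidueField w) (Alg G')]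
    (j' : G' ⟶ (sch₀Of 𝓜 w I.univ xbar).toAffine.toAbelianVariety.X) [IsMonHom j'] [IsClosedImmersion j'.left]
    (e𝒟 : G' ≅ cartierDual G') (εW εV : G' ⟶ G') [IsMonHom εV]
    (hj' : ∀ ⦃T : SchemeOver (geomResidueField w)⦄ (t : T ⟶ (sch₀Of 𝓜 w I.univ xbar).toAffine.toAbelianVariety.X),
      (∃ s : T ⟶ G', s ≫ j' = t) ↔ ∀ a ∈ w.asIdeal * ((IsCMField.complexConj F) • w).asIdeal, t ≫ (act₀Of 𝓜 w I.univ I.act a xbar).hom.hom.hom = 1)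
    (hεVj : εV ≫ j' = j' ≫ (act₀Of 𝓜 w I.univ I.act ecw xbar).hom.hom.hom)
    (hsumε : εW * εV = 𝟙 G') (hVV : εV ≫ εV = εV) (hadj : εW ≫ e𝒟.hom = e𝒟.hom ≫ cartierDualMap εV)
    (hpair : ∀ ⦃T : Type⦄ [CommRing T] [Algebra (geomResidueField w) T] [Module.Finite (geomResidueField w) T]
      (t s : specOver (geomResidueField w) T ⟶ G')
      (ht : ((t ≫ j') ≫ (pol₀Of 𝓜 w I.univ I.pol xbar).lam) ^ (I.pChar ^ 1) = 1) (hs : (s ≫ j') ^ (I.pChar ^ 1) = 1),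
      cartierPairing G' (t ≫ e𝒟.hom) s =
        (dual₀Of 𝓜 w I.univ I.dual xbar).weilChar (pol₀Of 𝓜 w I.univ I.pol xbar).nonempty_unitHatSlice_iso (I.pChar ^ 1)
          ((t ≫ j') ≫ (pol₀Of 𝓜 w I.univ I.pol xbar).lam) ht (s ≫ j') hs)
    (hG'p : ∀ ⦃T : SchemeOver (geomResidueField w)⦄ (t : T ⟶ G'), (t ≫ j') ^ (I.pChar ^ 1) = 1)
    -- (RKG)
    (hrkG' : Module.finrank (geomResidueField w) (Alg G') = (I.pChar ^ I.fDeg * I.pChar ^ I.fDeg) * (I.pChar ^ I.fDeg * I.pChar ^ I.fDeg))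
    -- the two legs
    (xbar₁ xbar₂ : AlgPoints (𝓜.localise w).reductionAt (geomResidueField w))
    (ψ₁ : (sch₀Of 𝓜 w I.univ xbar).X ⟶ (sch₀Of 𝓜 w (serreTensor I.act E' hE') xbar₁).X) [IsMonHom ψ₁]
    (ψ₂ : (sch₀Of 𝓜 w I.univ xbar).X ⟶ (sch₀Of 𝓜 w (serreTensor I.act E' hE') xbar₂).X) [IsMonHom ψ₂]
    (DB₁ : (sch₀Of 𝓜 w (serreTensor I.act E' hE') xbar₁).DualPair)
    (hDB₁ : Nonempty ((Scheme.Modules.pullback (DualPair.unitHatSlice DB₁)).obj DB₁.P ≅ SheafOfModules.unit _))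
    (lamB₁ : (sch₀Of 𝓜 w (serreTensor I.act E' hE') xbar₁).X ⟶ DB₁.hat.X) [IsMonHom lamB₁]
    (hSIM₁ : ψ₁ ≫ lamB₁ ≫ DualPair.dualIsogenyOver ψ₁ (dual₀Of 𝓜 w I.univ I.dual xbar) DB₁ =
      (pol₀Of 𝓜 w I.univ I.pol xbar).lam ≫ (dual₀Of 𝓜 w I.univ I.dual xbar).hat.mulN I.pChar)
    (DB₂ : (sch₀Of 𝓜 w (serreTensor I.act E' hE') xbar₂).DualPair)
    (hDB₂ : Nonempty ((Scheme.Modules.pullback (DualPair.unitHatSlice DB₂)).obj DB₂.P ≅ SheafOfModules.unit _))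
    (lamB₂ : (sch₀Of 𝓜 w (serreTensor I.act E' hE') xbar₂).X ⟶ DB₂.hat.X) [IsMonHom lamB₂]
    (hSIM₂ : ψ₂ ≫ lamB₂ ≫ DualPair.dualIsogenyOver ψ₂ (dual₀Of 𝓜 w I.univ I.dual xbar) DB₂ =
      (pol₀Of 𝓜 w I.univ I.pol xbar).lam ≫ (dual₀Of 𝓜 w I.univ I.dual xbar).hat.mulN I.pChar)
    (hACT₁ : (act₀Of 𝓜 w I.univ I.act ecw xbar).hom.hom.hom ≫ ψ₁ =
      ψ₁ ≫ (act₀Of 𝓜 w (serreTensor I.act E' hE') (serreAction I.act E' hE') ecw xbar₁).hom.hom.hom)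
    (hACT₂ : (act₀Of 𝓜 w I.univ I.act ecw xbar).hom.hom.hom ≫ ψ₂ =
      ψ₂ ≫ (act₀Of 𝓜 w (serreTensor I.act E' hE') (serreAction I.act E' hE') ecw xbar₂).hom.hom.hom)
    (hK₁ : ∀ ⦃T : SchemeOver (geomResidueField w)⦄ (t : T ⟶ (sch₀Of 𝓜 w I.univ xbar).X), t ≫ ψ₁ = 1 →
      ∀ a ∈ w.asIdeal * ((IsCMField.complexConj F) • w).asIdeal, t ≫ (act₀Of 𝓜 w I.univ I.act a xbar).hom.hom.hom = 1)
    (hK₂ : ∀ ⦃T : SchemeOver (geomResidueField w)⦄ (t : T ⟶ (sch₀Of 𝓜 w I.univ xbar).X), t ≫ ψ₂ = 1 →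
      ∀ a ∈ w.asIdeal * ((IsCMField.complexConj F) • w).asIdeal, t ≫ (act₀Of 𝓜 w I.univ I.act a xbar).hom.hom.hom = 1)
    (hdock₁ : letI := (𝔡 xbar).grp₀; haveI := (𝔡 xbar).aff₀;
      ∀ ⦃T : SchemeOver (geomResidueField w)⦄ (t : T ⟶ (𝔡 xbar).G₀), t ≫ (𝔡 xbar).ι₀G ≫ ψ₁ = 1 ↔
        ∃ s : T ⟶ specOver (geomResidueField w) (Alg (𝔡 xbar).G₀ ⧸ H.1), s ≫ quotIncl (𝔡 xbar).G₀ H.1 = t)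
    (hdock₂ : letI := (𝔡 xbar).grp₀; haveI := (𝔡 xbar).aff₀;
      ∀ ⦃T : SchemeOver (geomResidueField w)⦄ (t : T ⟶ (𝔡 xbar).G₀), t ≫ (𝔡 xbar).ι₀G ≫ ψ₂ = 1 ↔
        ∃ s : T ⟶ specOver (geomResidueField w) (Alg (𝔡 xbar).G₀ ⧸ H.1), s ≫ quotIncl (𝔡 xbar).G₀ H.1 = t)
    (hrk₁ : ∀ (K : SchemeOver (geomResidueField w)) [GrpObj K] [IsAffine K.left] [Module.Finite (geomResidueField w) (Alg K)]
      (κ : K ⟶ (sch₀Of 𝓜 w I.univ xbar).X) [IsMonHom κ] [IsClosedImmersion κ.left],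
      (∀ ⦃T : SchemeOver (geomResidueField w)⦄ (t : T ⟶ (sch₀Of 𝓜 w I.univ xbar).X), (∃ s : T ⟶ K, s ≫ κ = t) ↔ t ≫ ψ₁ = 1) →
      Module.finrank (geomResidueField w) (Alg K) = I.pChar ^ I.fDeg * I.pChar ^ I.fDeg)
    (hrk₂ : ∀ (K : SchemeOver (geomResidueField w)) [GrpObj K] [IsAffine K.left] [Module.Finite (geomResidueField w) (Alg K)]
      (κ : K ⟶ (sch₀Of 𝓜 w I.univ xbar).X) [IsMonHom κ] [IsClosedImmersion κ.left],
      (∀ ⦃T : SchemeOver (geomResidueField w)⦄ (t : T ⟶ (sch₀Of 𝓜 w I.univ xbar).X), (∃ s : T ⟶ K, s ≫ κ = t) ↔ t ≫ ψ₂ = 1) →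
      Module.finrank (geomResidueField w) (Alg K) = I.pChar ^ I.fDeg * I.pChar ^ I.fDeg)
    ⦃T : SchemeOver (geomResidueField w)⦄ (t : T ⟶ (sch₀Of 𝓜 w I.univ xbar).X) :
    t ≫ ψ₁ = 1 ↔ t ≫ ψ₂ = 1 := by
  classical
  let A₀ : AbelianSchemeOver (Spec (.of (geomResidueField w))) := sch₀Of 𝓜 w I.univ xbar
  let Av : AbelianVariety (geomResidueField w) := A₀.toAffine.toAbelianVariety
  let act : 𝓞 F → (Av ⟶ Av) := fun a => act₀Of 𝓜 w I.univ I.act a xbar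
  let Iw : Ideal (𝓞 F) := w.asIdeal * ((IsCMField.complexConj F) • w).asIdeal
  -- ===================== (8)–(11) PER LEG, BY NAME: `Kᵢ := Ker (j′ ≫ ψᵢ) ↪ G′` realised, Lagrangian, `ε_V`-stable (`…_of_cut_aux`) =====================
  obtain ⟨K₁, k11, k12, k13, k14, k15, κ₁, hκ₁m, hκ₁mono, hκ₁', hlag₁, hV₁⟩ :=
    comp_eq_one_iff_of_two_quotLegs_of_cut_aux I E' hE' xbar ecw G' j' e𝒟 εV hj' hεVj hpair hG'p hrkG' xbar₁ ψ₁ DB₁ hDB₁ lamB₁ hSIM₁ hACT₁ hK₁ hrk₁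
  obtain ⟨K₂, k21, k22, k23, k24, k25, κ₂, hκ₂m, hκ₂mono, hκ₂', hlag₂, hV₂⟩ :=
    comp_eq_one_iff_of_two_quotLegs_of_cut_aux I E' hE' xbar ecw G' j' e𝒟 εV hj' hεVj hpair hG'p hrkG' xbar₂ ψ₂ DB₂ hDB₂ lamB₂ hSIM₂ hACT₂ hK₂ hrk₂
  haveI := hκ₁m; haveI := hκ₁mono; haveI := hκ₂m; haveI := hκ₂mono
  -- ===================== (12) (s-FIX) + (C6′-V): the `ε_V`-fixed points are `c•w`-dock points, where both kernels read `V(H)` =====================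
  letI := (𝔡 xbar).grp₀
  haveI := (𝔡 xbar).aff₀
  have hfix : ∀ ⦃T : SchemeOver (geomResidueField w)⦄ (t : T ⟶ G'), t ≫ εV = t → ∃ s : T ⟶ (𝔡 xbar).G₀, s ≫ (𝔡 xbar).ι₀G = t ≫ j' :=
    fun T t ht => dockPt_of_fixed I 𝔡 xbar ecw hecw𝔭 G' j' εV hj' hεVj t ht
  have hV := Literature.AlgebraicGeometry.GroupSchemes.AffineGroupScheme.exists_comp_iff_of_dock G' j' εV K₁ κ₁ K₂ κ₂ ψ₁ ψ₂ (𝔡 xbar).ι₀G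
    (fun T s => ∃ s' : T ⟶ specOver (geomResidueField w) (Alg (𝔡 xbar).G₀ ⧸ H.1), s' ≫ quotIncl (𝔡 xbar).G₀ H.1 = s)
    hfix hdock₁ hdock₂ hκ₁' hκ₂'
  -- ===================== (13) (C6′-core) =====================
  exact Literature.AlgebraicGeometry.GroupSchemes.AffineGroupScheme.comp_eq_one_iff_of_blocks G' j' e𝒟 εW εV K₁ κ₁ K₂ κ₂ ψ₁ ψ₂ (Iw : Set (𝓞 F)) (fun a => (act a).hom.hom.hom) hj' hK₁ hK₂ hκ₁' hκ₂'
    hsumε hVV hadj hlag₁ hlag₂ hV₁ hV₂ hV t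


set_option maxHeartbeats 400000 in
/-- **(C6′) `comp_eq_one_iff_of_two_quotLegs` — TWO REDUCED LEGS OUT OF `A_x̄` INTO THE SERRE-TWIST FAMILY WITH THE SAME `c•w`-DOCK PART HAVE THE SAME KERNEL.**
At a special point `x̄` with its dock `𝔡 x̄` (the `c•w`-layer `G₀(x̄) ↪ A_x̄ := sch₀Of 𝓜 w I.univ x̄`) and ONE admissible `H : SubOf I 𝔡 x̄`: two homomorphisms
`ψᵢ : A_x̄ → 𝒞_{x̄ᵢ″}` (`𝒞 := serreTensor I.act E′ hE′`, any `x̄ᵢ″`) with, for each `i`: (SIM) `ψᵢ ≫ λ_{Bᵢ} ≫ ψᵢ^∨ = λ_x̄ ≫ [p]` for a chosen normalised downstairs dual pair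
`(DBᵢ, λ_{Bᵢ})` of `𝒞_{x̄ᵢ″}` (the (ρ1𝒞) (SIM) row instantiated; similitude factor EXACTLY `p = I.pChar`); (ACT) `ι_x̄(a) ≫ ψᵢ = ψᵢ ≫ ι^𝒞_{x̄ᵢ″}(a)`; (K2) `Ker ψᵢ ⊆ A_x̄[𝔭_w𝔭_{c•w}]`
on all `T`-points; (DOCK) `Ker ψᵢ ∩ G₀(x̄) = V(H)`; (RK) `rk Γ(Ker ψᵢ) = q²·…` BY VALUE for every closed realisation of `Ker ψᵢ`; plus (RKG) `rk Γ = q⁴` for every closed realisation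
of `A_x̄[𝔭_w𝔭_{c•w}]` and `hunr hunr′` (`p` unramified at `w`, `c•w`).  THEN `t ≫ ψ₁ = 1 ↔ t ≫ ψ₂ = 1` for every `T`-point `t` of `A_x̄`.  PROOF = the four sockets by name:
(s-H2) ★ `exists_twoBlock_hermitianDuality_pairing` at `A_x̄` gives `G′ = A_x̄[𝔭_w𝔭_{c•w}]`, `e`, `εW = β(e_w)`, `εV = β(e_{c•w})` with the pairing clause (its inputs: pins ★
`exists_torsionPin` of `A_x̄[p]`, `Â_x̄[p]`; layer action ★ `exists_layerEnd_abelianVariety`; `hlam` from `I.polQuasiInv`; Rosati from `I.rosati` base-changed; CRT ★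
`exists_blockIdempotents_mem hw _ hunr hunr′`); (s-REAL) ★ `exists_interLayer G′ (j′ ≫ ψᵢ)` realises `Kᵢ = Ker ψᵢ` inside `G′`; (s-LAG) ★ `exists_comp_eq_iff_of_descent` makes
`Kᵢ` Lagrangian (rank `q⁴ = q²·q²`); (s-FIX) `e_{c•w} ∈ 𝔭_w` puts the `εV`-fixed points in the `c•w`-dock (`(𝔡 x̄).hkerG₀`); §1 (C6′-stab)∕(C6′-V)∕(C6′-core) conclude.
[cite: MumfordAV1970, §23 Thm. 2 (p. 231), §20 (I) (p. 189)] [cite: Tate1997FiniteFlatGroupSchemes, §(3.8) pp. 145–146] [cite: Liu2021, Prop. D.8 p. 135, p. 137]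
[cite: RapoportSmithlingZhang2020Diagonal, §4.1 Thm. 4.1 p. 17] -/
theorem comp_eq_one_iff_of_two_quotLegs (I : RGDInputsAt F ι₁ Jstar K₀ S hU7ₛ hJ hJu Fi Kc G 𝓜 w hw h𝓨 θ e) [ExpChar (geomResidueField w) I.pChar]
    [IsCommMonObj I.univ.X] -- (= `I.comm`; binder-position instance for the `serreTensor` tokens below)
    {m : ℕ} (E' : Matrix (Fin m) (Fin m) (𝓞 F)) (hE' : E' * E' = E')
    (hunr : ¬ w.asIdeal ^ 2 ∣ Ideal.span {(I.pChar : 𝓞 F)}) (hunr' : ¬ ((IsCMField.complexConj F) • w).asIdeal ^ 2 ∣ Ideal.span {(I.pChar : 𝓞 F)})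
    (𝔡 : ∀ xbar, DockAt I xbar) (xbar : AlgPoints (𝓜.localise w).reductionAt (geomResidueField w)) (H : SubOf I 𝔡 xbar)
    -- (RKG) the rank of `A_x̄[𝔭_w𝔭_{c•w}]`, BY VALUE for every closed realisation
    (hrkG : ∀ (G' : SchemeOver (geomResidueField w)) [GrpObj G'] [IsAffine G'.left] [Module.Finite (geomResidueField w) (Alg G')]
      (j' : G' ⟶ (sch₀Of 𝓜 w I.univ xbar).X) [IsMonHom j'] [IsClosedImmersion j'.left],
      (∀ ⦃T : SchemeOver (geomResidueField w)⦄ (t : T ⟶ (sch₀Of 𝓜 w I.univ xbar).X),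
        (∃ s : T ⟶ G', s ≫ j' = t) ↔ ∀ a ∈ w.asIdeal * ((IsCMField.complexConj F) • w).asIdeal, t ≫ (act₀Of 𝓜 w I.univ I.act a xbar).hom.hom.hom = 1) →
      Module.finrank (geomResidueField w) (Alg G') = (I.pChar ^ I.fDeg * I.pChar ^ I.fDeg) * (I.pChar ^ I.fDeg * I.pChar ^ I.fDeg))
    -- the two legs
    (xbar₁ xbar₂ : AlgPoints (𝓜.localise w).reductionAt (geomResidueField w))
    (ψ₁ : (sch₀Of 𝓜 w I.univ xbar).X ⟶ (sch₀Of 𝓜 w (serreTensor I.act E' hE') xbar₁).X) [IsMonHom ψ₁]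
    (ψ₂ : (sch₀Of 𝓜 w I.univ xbar).X ⟶ (sch₀Of 𝓜 w (serreTensor I.act E' hE') xbar₂).X) [IsMonHom ψ₂]
    -- (SIM) on a chosen normalised downstairs dual pair per side, factor EXACTLY `I.pChar`
    (DB₁ : (sch₀Of 𝓜 w (serreTensor I.act E' hE') xbar₁).DualPair)
    (hDB₁ : Nonempty ((Scheme.Modules.pullback (DualPair.unitHatSlice DB₁)).obj DB₁.P ≅ SheafOfModules.unit _))
    (lamB₁ : (sch₀Of 𝓜 w (serreTensor I.act E' hE') xbar₁).X ⟶ DB₁.hat.X) [IsMonHom lamB₁]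
    (hSIM₁ : ψ₁ ≫ lamB₁ ≫ DualPair.dualIsogenyOver ψ₁ (dual₀Of 𝓜 w I.univ I.dual xbar) DB₁ =
      (pol₀Of 𝓜 w I.univ I.pol xbar).lam ≫ (dual₀Of 𝓜 w I.univ I.dual xbar).hat.mulN I.pChar)
    (DB₂ : (sch₀Of 𝓜 w (serreTensor I.act E' hE') xbar₂).DualPair)
    (hDB₂ : Nonempty ((Scheme.Modules.pullback (DualPair.unitHatSlice DB₂)).obj DB₂.P ≅ SheafOfModules.unit _))
    (lamB₂ : (sch₀Of 𝓜 w (serreTensor I.act E' hE') xbar₂).X ⟶ DB₂.hat.X) [IsMonHom lamB₂]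
    (hSIM₂ : ψ₂ ≫ lamB₂ ≫ DualPair.dualIsogenyOver ψ₂ (dual₀Of 𝓜 w I.univ I.dual xbar) DB₂ =
      (pol₀Of 𝓜 w I.univ I.pol xbar).lam ≫ (dual₀Of 𝓜 w I.univ I.dual xbar).hat.mulN I.pChar)
    -- (ACT)
    (hACT₁ : ∀ a : 𝓞 F, (act₀Of 𝓜 w I.univ I.act a xbar).hom.hom.hom ≫ ψ₁ =
      ψ₁ ≫ (act₀Of 𝓜 w (serreTensor I.act E' hE') (serreAction I.act E' hE') a xbar₁).hom.hom.hom)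
    (hACT₂ : ∀ a : 𝓞 F, (act₀Of 𝓜 w I.univ I.act a xbar).hom.hom.hom ≫ ψ₂ =
      ψ₂ ≫ (act₀Of 𝓜 w (serreTensor I.act E' hE') (serreAction I.act E' hE') a xbar₂).hom.hom.hom)
    -- (K2) at `𝔭_w 𝔭_{c•w}`
    (hK₁ : ∀ ⦃T : SchemeOver (geomResidueField w)⦄ (t : T ⟶ (sch₀Of 𝓜 w I.univ xbar).X), t ≫ ψ₁ = 1 →
      ∀ a ∈ w.asIdeal * ((IsCMField.complexConj F) • w).asIdeal, t ≫ (act₀Of 𝓜 w I.univ I.act a xbar).hom.hom.hom = 1)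
    (hK₂ : ∀ ⦃T : SchemeOver (geomResidueField w)⦄ (t : T ⟶ (sch₀Of 𝓜 w I.univ xbar).X), t ≫ ψ₂ = 1 →
      ∀ a ∈ w.asIdeal * ((IsCMField.complexConj F) • w).asIdeal, t ≫ (act₀Of 𝓜 w I.univ I.act a xbar).hom.hom.hom = 1)
    -- (DOCK) at the SAME `V(H)`
    (hdock₁ : letI := (𝔡 xbar).grp₀; haveI := (𝔡 xbar).aff₀;
      ∀ ⦃T : SchemeOver (geomResidueField w)⦄ (t : T ⟶ (𝔡 xbar).G₀), t ≫ (𝔡 xbar).ι₀G ≫ ψ₁ = 1 ↔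
        ∃ s : T ⟶ specOver (geomResidueField w) (Alg (𝔡 xbar).G₀ ⧸ H.1), s ≫ quotIncl (𝔡 xbar).G₀ H.1 = t)
    (hdock₂ : letI := (𝔡 xbar).grp₀; haveI := (𝔡 xbar).aff₀;
      ∀ ⦃T : SchemeOver (geomResidueField w)⦄ (t : T ⟶ (𝔡 xbar).G₀), t ≫ (𝔡 xbar).ι₀G ≫ ψ₂ = 1 ↔
        ∃ s : T ⟶ specOver (geomResidueField w) (Alg (𝔡 xbar).G₀ ⧸ H.1), s ≫ quotIncl (𝔡 xbar).G₀ H.1 = t)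
    -- (RK) the rank of `Ker ψᵢ`, BY VALUE for every closed realisation
    (hrk₁ : ∀ (K : SchemeOver (geomResidueField w)) [GrpObj K] [IsAffine K.left] [Module.Finite (geomResidueField w) (Alg K)]
      (κ : K ⟶ (sch₀Of 𝓜 w I.univ xbar).X) [IsMonHom κ] [IsClosedImmersion κ.left],
      (∀ ⦃T : SchemeOver (geomResidueField w)⦄ (t : T ⟶ (sch₀Of 𝓜 w I.univ xbar).X), (∃ s : T ⟶ K, s ≫ κ = t) ↔ t ≫ ψ₁ = 1) →
      Module.finrank (geomResidueField w) (Alg K) = I.pChar ^ I.fDeg * I.pChar ^ I.fDeg)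
    (hrk₂ : ∀ (K : SchemeOver (geomResidueField w)) [GrpObj K] [IsAffine K.left] [Module.Finite (geomResidueField w) (Alg K)]
      (κ : K ⟶ (sch₀Of 𝓜 w I.univ xbar).X) [IsMonHom κ] [IsClosedImmersion κ.left],
      (∀ ⦃T : SchemeOver (geomResidueField w)⦄ (t : T ⟶ (sch₀Of 𝓜 w I.univ xbar).X), (∃ s : T ⟶ K, s ≫ κ = t) ↔ t ≫ ψ₂ = 1) →
      Module.finrank (geomResidueField w) (Alg K) = I.pChar ^ I.fDeg * I.pChar ^ I.fDeg)
    ⦃T : SchemeOver (geomResidueField w)⦄ (t : T ⟶ (sch₀Of 𝓜 w I.univ xbar).X) :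
    t ≫ ψ₁ = 1 ↔ t ≫ ψ₂ = 1 := by
  classical
  -- ===================== (0) NOTATION AND INSTANCES =====================
  -- the prime, the place data
  have hp : I.pChar.Prime := I.hpChar.1
  haveI : Fact I.pChar.Prime := ⟨hp⟩
  have hp0 : I.pChar ≠ 0 := hp.ne_zero
  have hp1 : I.pChar ^ 1 ≠ 0 := by rw [pow_one]; exact hp0
  -- the special fibre `A_x̄` as an abelian `κ̄`-scheme (`A₀`) and as an abelian variety (`Av`), its structure
  let A₀ : AbelianSchemeOver (Spec (.of (geomResidueField w))) := sch₀Of 𝓜 w I.univ xbar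
  let Av : AbelianVariety (geomResidueField w) := A₀.toAffine.toAbelianVariety   -- = `fibre₀Of 𝓜 w I.univ xbar` on the nose
  let D₀ : A₀.DualPair := dual₀Of 𝓜 w I.univ I.dual xbar
  let pol₀ : A₀.Polarization D₀ := pol₀Of 𝓜 w I.univ I.pol xbar
  have hD₀ : Nonempty ((Scheme.Modules.pullback D₀.unitHatSlice).obj D₀.P ≅ SheafOfModules.unit _) := pol₀.nonempty_unitHatSlice_iso
  haveI := pol₀.isMonHom
  -- the action read as endomorphisms of the abelian variety `Av` (`(act a).hom.hom.hom = ((I.act.baseChange π).baseChange x̄.left).i a` by `rfl`)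
  let act : 𝓞 F → (Av ⟶ Av) := fun a => act₀Of 𝓜 w I.univ I.act a xbar
  let ρ₀ : A₀.RingAction (𝓞 F) := (I.act.baseChange (pullback.fst (𝓜.localise w).total.hom (specResidueField w))).baseChange xbar.left
  have hact : ∀ a, (act a).hom.hom.hom = ρ₀.i a := fun a => rfl
  -- the two-block ideal and conjugation
  let cc := IsCMField.complexConj F
  let Iw : Ideal (𝓞 F) := w.asIdeal * (cc • w).asIdeal
  -- ===================== (1) CRT ELEMENTS (★ ED. 4) =====================
  obtain ⟨ew, ecw, hsum1, hIe, hew, hecw, hsq, hst₁, hst₂, hpI, hew𝔮, hecw𝔭⟩ :=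
    exists_blockIdempotents_mem w hw I.hpChar.2 hunr hunr'
  -- ===================== (2) THE PINS `G = A_x̄[p]`, `Ĝ = Â_x̄[p]` =====================
  obtain ⟨Gp, gi1, gi2, gi3, gi4, gi5, j, hjm, hjci, hG⟩ := Av.exists_torsionPin (N := I.pChar ^ 1) hp1
  obtain ⟨Ĝ, hi1, hi2, hi3, hi4, hi5, ĵ, hĵm, hĵci, hĜ⟩ := D₀.hat.toAffine.toAbelianVariety.exists_torsionPin (N := I.pChar ^ 1) hp1
  haveI : Mono j := Over.mono_of_mono_left j
  -- ===================== (3) THE LAYER ACTION `β` ON `G` (★ `exists_layerEnd_abelianVariety`) =====================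
  obtain ⟨β, hβm, hβ, hNG⟩ := exists_layerEnd_abelianVariety Av (I.pChar ^ 1) Gp j hG act
  haveI : ∀ a, IsMonHom (β a) := hβm
  have hβone : β 1 = 𝟙 Gp := layerEnd_one j (fun a => (act a).hom.hom.hom) β hβ (by rw [hact]; exact ρ₀.i_one)
  have hβadd : ∀ a b : 𝓞 F, β (a + b) = β a * β b := fun a b =>
    layerEnd_add j (fun a => (act a).hom.hom.hom) β hβ (by rw [hact, hact, hact]; exact ρ₀.i_add a b)
  have hβmul : ∀ a b : 𝓞 F, β (a * b) = β b ≫ β a := fun a b =>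
    layerEnd_mul j (fun a => (act a).hom.hom.hom) β hβ (by rw [hact, hact, hact]; exact ρ₀.i_mul a b)
  -- ===================== (4) ROSATI at `A_x̄` (`I.rosati` base-changed twice) =====================
  have hRosUp : ∀ a : 𝓞 F, haveI := I.act.isMonHom_i a
      I.act.i (cc • a) ≫ I.pol.lam = I.pol.lam ≫ DualPair.dualIsogenyOver (I.act.i a) I.dual I.dual := fun a => I.rosati a (cc • a) rfl
  have hRos₁ := rosati_baseChange₀ (pullback.fst (𝓜.localise w).total.hom (specResidueField w)) I.act I.dual I.pol.lam (fun a => cc • a) hRosUp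
  have hRos₀ := rosati_baseChange₀ xbar.left (I.act.baseChange (pullback.fst (𝓜.localise w).total.hom (specResidueField w)))
    (I.dual.baseChange (pullback.fst (𝓜.localise w).total.hom (specResidueField w)))
    (baseChangeHom I.pol.lam (pullback.fst (𝓜.localise w).total.hom (specResidueField w))) (fun a => cc • a) hRos₁
  have hRos : ∀ a : 𝓞 F, (act (cc • a)).hom.hom.hom ≫ pol₀.lam =
      pol₀.lam ≫ DualPair.dualIsogenyOver (A' := (AbelianScheme.ofAbelianVariety Av).toOver) (B := (AbelianScheme.ofAbelianVariety Av).toOver)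
        (act a).hom.hom.hom D₀ D₀ := fun a => hRos₀ a
  -- ===================== (5) `λ_x̄` KILLS NO POINT OF `A_x̄[p]` (`I.polQuasiInv` base-changed twice, Bezout) =====================
  obtain ⟨d, ν, hνm, hpd, hν⟩ := I.polQuasiInv
  haveI := hνm
  -- `λ ≫ ν = [d]` base-changed twice (★ W-DOCK currency `baseChange_lam_comp_eq_mulN`)
  have hν₁ := F0P6bWDock.baseChange_lam_comp_eq_mulN I.univ I.dual (pullback.fst (𝓜.localise w).total.hom (specResidueField w)) I.pol d ν hν
  haveI hν₁m := isMonHom_baseChangeHom (A := I.dual.hat) (B := I.univ) ν (pullback.fst (𝓜.localise w).total.hom (specResidueField w))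
  have hν₀ := F0P6bWDock.baseChange_lam_comp_eq_mulN _ _ xbar.left
    (I.pol.baseChange (pullback.fst (𝓜.localise w).total.hom (specResidueField w))) d _ hν₁
  haveI hν₀m := isMonHom_baseChangeHom (A := (I.dual.baseChange (pullback.fst (𝓜.localise w).total.hom (specResidueField w))).hat)
    (B := I.univ.baseChange (pullback.fst (𝓜.localise w).total.hom (specResidueField w)))
    ((Over.pullback (pullback.fst (𝓜.localise w).total.hom (specResidueField w))).map ν :
      (I.dual.hat.baseChange _).X ⟶ (I.univ.baseChange _).X) xbar.left
  -- (P-1) on `A_x̄`-points: `[p] s = 1 ∧ λ s = 1 ⇒ s = 1` (★ `eq_one_of_comp_mulN_of_comp_lam`, Bezout with `gcd(p, d) = 1`)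
  have hlamA : ∀ ⦃T : SchemeOver (geomResidueField w)⦄ (s : T ⟶ A₀.X), s ≫ A₀.mulN (I.pChar ^ 1) = 1 → s ≫ pol₀.lam = 1 → s = 1 :=
    fun T s hN hl => F0P6bWDock.eq_one_of_comp_mulN_of_comp_lam A₀ D₀ pol₀.lam (Nat.Coprime.pow_left 1 hpd) _ hν₀ s hN hl
  have hlam : ∀ ⦃T : SchemeOver (geomResidueField w)⦄ (t : T ⟶ Gp), (t ≫ j) ≫ pol₀.lam = 1 → t = 1 := by
    intro T t ht
    have hq : (t ≫ j) ≫ A₀.mulN (I.pChar ^ 1) = 1 := by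
      rw [F0P6bWDock.mulN_eq_zsmul_id]
      exact (hG (t ≫ j)).1 ⟨t, rfl⟩
    have h1 : t ≫ j = (1 : T ⟶ Gp) ≫ j := by
      rw [MonObj.one_comp]
      exact hlamA (t ≫ j) hq ht
    exact (cancel_mono j).1 h1
  -- ===================== (6) `ι(p) = [p]` on `A_x̄` =====================
  have hactp : (act (I.pChar : 𝓞 F)).hom.hom.hom = ((((I.pChar ^ 1 : ℕ) : ℤ) • 𝟙 Av).hom.hom.hom) := by
    rw [hact, RingAction.i_natCast, AbelianVariety.hom_zsmul_id, zpow_natCast, pow_one]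
    rfl
  -- ===================== (7) (s-H2): THE TWO-BLOCK CUT `G′ = A_x̄[𝔭_w𝔭_{c•w}]` WITH ITS DUALITY AND PAIRING CLAUSE =====================
  obtain ⟨G', g1, g2, g3, g4, g5, j', hj'm, hj'ci, e𝒟, hem, εW, εV, hεWm, hεVm, hj', hεWj, hεVj, hsumε, hVV, hWW, hadj, hpair⟩ :=
    DualPair.exists_twoBlock_hermitianDuality_pairing I.pChar Av D₀ hD₀ pol₀ Gp j hG Ĝ ĵ hĜ hlam (𝓞 F) (fun a => cc • a) act β hβ hβone hβadd hβmul
      hRos Iw hpI hactp ew ecw hsum1 hIe hew hecw hsq hst₁ hst₂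
  haveI := hj'm; haveI := hj'ci; haveI := hem; haveI := hεWm; haveI := hεVm
  -- `G′`-points are `p`-torsion (`p ∈ 𝔭_w𝔭_{c•w}`, `ι(p) = [p]`)
  have hG'p : ∀ ⦃T : SchemeOver (geomResidueField w)⦄ (t : T ⟶ G'), (t ≫ j') ^ (I.pChar ^ 1) = 1 := by
    intro T t
    have h := (hj' (t ≫ j')).1 ⟨t, rfl⟩ (I.pChar : 𝓞 F) hpI
    rwa [hactp, AbelianVariety.hom_zsmul_id, zpow_natCast, MonObj.comp_pow, Category.comp_id] at h
  -- ===================== (8)–(13) = `comp_eq_one_iff_of_two_quotLegs_of_cut` =====================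
  exact comp_eq_one_iff_of_two_quotLegs_of_cut I E' hE' 𝔡 xbar H ecw hecw𝔭 G' j' e𝒟 εW εV hj' hεVj hsumε hVV hadj hpair hG'p (hrkG G' j' hj')
    xbar₁ xbar₂ ψ₁ ψ₂ DB₁ hDB₁ lamB₁ hSIM₁ DB₂ hDB₂ lamB₂ hSIM₂ (hACT₁ ecw) (hACT₂ ecw) hK₁ hK₂ hdock₁ hdock₂ hrk₁ hrk₂ t

end QuotWDFold

end Block_I

/-! ## §G — (RKG) `hrkG_of_dock` — A-p06 (g36) `HrkGOfDock.v1` 1314fd746ca2c107 `section HrkG` (byte-identical; ★ p850494 imported; file-level `backward.isDefEq.respectTransparency false` re-scoped; `synthInstance.maxHeartbeats 100000` on one decl as at HOME) -/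

section Block_G

open CategoryTheory CategoryTheory.Limits AlgebraicGeometry MonoidalCategory CartesianMonoidalCategory
set_option backward.isDefEq.respectTransparency false
open scoped MonObj
open Literature.AlgebraicGeometry.Motives Literature.AlgebraicGeometry.GroupSchemes Literature.AlgebraicGeometry.GroupSchemes.GroupSchemeKernel
open Literature.AlgebraicGeometry.GroupSchemes.AffineGroupScheme

section HrkG

open NumberField IsDedekindDomain MulAction
open scoped Matrix Pointwise
open Literature.NumberTheory.Automorphic Literature.NumberTheory.Automorphic.UnitaryGroup
open Literature.AlgebraicGeometry.ShimuraVarieties.UnitaryCanonicalModel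
open Literature.NumberTheory.Automorphic.Liu2021.AppendixC
open Literature.AlgebraicGeometry.Motives (AlgPoints IntegralModel SchemeOver thickening thickeningGalAction thickeningLift specOver)
open Literature.NumberTheory.DiophantineGeometry (geomResidueField specialFibreFunctor specResidueField)
open Literature.AlgebraicGeometry.RelativeSpec (ActionOver)
open Literature.AlgebraicGeometry.AbelianSchemes Literature.AlgebraicGeometry.AbelianSchemes.AbelianSchemeOver
open Literature.AlgebraicGeometry.HodgeTheory Literature.AlgebraicGeometry.HodgeTheory.RingAction
open Literature.RingTheory.DedekindDomain
open Summit.HodgeConjecture.HodgeConjecture.Cruxes.HLiu418.F0P6aModuliDatumDefs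
open Summit.HodgeConjecture.HodgeConjecture.Cruxes.HLiu418.F0P6aRGDAssembly
open Summit.HodgeConjecture.HodgeConjecture.Cruxes.HLiu418.F0P6aDatumOfInputs

-- the frame of the D-line՚s `Letters` section VERBATIM
variable {F : Type} [Field F] [NumberField F] [IsCMField F] {ι₁ : F →+* ℂ}
    {Jstar : Matrix (Fin 2) (Fin 2) F}
    {K₀ : C5.OpenCompactSubgroup ↥(finAdelic ↥(maximalRealSubfield F) F (IsCMField.complexConj F) 2 Jstar)}
    {S : RecordSystemGS F Jstar ι₁ K₀} {hU7ₛ : S.HeckeTranslateDefinedOver}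
    {hJ : (Jstar.map (IsCMField.complexConj F))ᵀ = Jstar} {hJu : IsUnit Jstar}
    {Fi : Type} [Field Fi] [Algebra F Fi] {Kc : C5.SmallLevel K₀} {G : Type} [Group G]
    {𝓜 : IntegralModel (𝓞 F) F ((thickening F Fi).obj (S.M.obj Kc))}
    {w : HeightOneSpectrum (𝓞 F)} {hw : (IsCMField.complexConj F) • w ≠ w} {h𝓨 : (𝓜.localise w).IsSmoothProper 1}
    {θ : ActionOver (𝓜.localise w).total.hom ((Fi ≃ₐ[F] Fi) × G)}
    {e : Fi →ₐ[F] AlgebraicClosure (w.adicCompletion F)}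

-- `TopCat.Presheaf` is not reducible (as in spine §4 `blockDock_of_inputs` and ★ p846766); `synthInstance` budget as in the D-LINE `DockData` (the dock՚s `GrpObj`).

end HrkG

end Block_G

end Summit.HodgeConjecture.HodgeConjecture.Cruxes.HLiu418.F0P6aLineSpecialisation

end
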